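import Mathlib
import HarnessLib.Audit
import Summits.PneNP.PneNP.Theorems.PstarChordReadPairCore
import Summits.PneNP.PneNP.Theorems.PstarGapTwoTerminal

/-!
# The terminal normal form of a two-constraint core, with provenance (ROUND-24, O1 at exact tightness; memo g21 §17.5)

FRONTIER range-avoidance ladder, rung F-N3, ROUND 24 (cell `pnp-ideate`, prover-2 memo `g21/O1-CHORD-READ-g21.md` §17.5; typed target
`PstarCoreBoundTargets.TerminalPeelable` (p646951); restricted-model proof complexity — nothing here bears on `P` versus `NP`).

`PstarChordReadPairCore.sliceGeneric_of_no_pairCore` reduced the one non-kernel input of the O1-at-`k = 12` chain (slice genericity of a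
chord `c`) to the absence of PAIR-CORES inside `J₀ ∖ c` — two-constraint minimal infeasible systems that are NOT `Terminal` cores (no
XOR-closedness).  This file runs the GapTwo normalisation (`PstarGapTwoTerminal`: folding outputs with a private XOR slot into the constraints,
`PstarGSystemFold.fold`) on ANY two-constraint core and KEEPS THE PROVENANCE of the two constraints:

* `Descends I y w F d` — `d` is obtained from the G-constraint `w` by folding the output set `F`: monomials `w.2.1 ∪ F`, linear part `= w.1`
  corrected at the odd vertices of the XOR multigraph of `F` (`v ∈ d.1 ↔ (v ∈ w.1 ↔ xpdeg_F v even)`), and on assignments satisfying `F` it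
  holds iff `w` does (`descends_empty`, `descends_fold`, `Descends.mem_lin`).
* `false_of_inv_card_le_one` — on an expanding instance a normalisation state (`PstarGapTwoTerminal.Inv`) with at most ONE constraint is
  contradictory (`gSat` / feasibility / non-constancy): two-constraint cores never lose a constraint, so no row reduction ever completes.
* **`twoCore_normalForm`** — a non-empty `K` (`#K < r`) with two G-constraints `w₁, w₂` (monomials off `K`, inside the radius), (T3)+(M0) and
  the per-monomial flip property (M′), normalises to: `K₀ ⊆ K` XOR-CLOSED, fold sets `F₁, F₂ ⊆ K ∖ K₀` covering `K ∖ K₀`, DISTINCT descendants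
  `d₁, d₂` of `w₁, w₂` satisfying (T2′) (every linear variable read by `K₀` or an AND slot of a monomial), (T3), (M0), (M′); hence
  `Terminal I r y K₀ d₁ d₂` when `K₀ ≠ ∅`, and an EMPTY-CORE COINCIDENCE (`d₁ ∧ d₂` unsatisfiable over ALL assignments) when `K₀ = ∅`.

The pair-core instance (the `ℓ`-descendant is a path sum) is `PstarPairCoreNormal`.  No Assumption A anywhere.
-/

set_option linter.dupNamespace false -- `Summit.PneNP.PneNP.…`: summit = sub-problem name (D-0017 single-conjunct layout)

open Finset Literature.Computability.Complexity
open scoped symmDiff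
open Summit.PneNP.PneNP.Theorems.PstarTyped (Typed)
open Summit.PneNP.PneNP.Theorems.PstarSALevel (varSet bdry BoundaryExpanding SimpleOverlap)
open Summit.PneNP.PneNP.Theorems.PstarGapPeeling (feasible_of_boundaryExpanding)
open Summit.PneNP.PneNP.Theorems.PstarCentreFree (vars_mem_varSet)
open Summit.PneNP.PneNP.Theorems.PstarGapOneAll (gval)
open Summit.PneNP.PneNP.Theorems.PstarGConstraint (eq_empty_of_gval_const andPairs_simple gval_false)
open Summit.PneNP.PneNP.Theorems.PstarGSat (gSat)
open Summit.PneNP.PneNP.Theorems.PstarCoreBound (XorClosed)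
open Summit.PneNP.PneNP.Theorems.PstarCoreBoundTargets (Terminal)
open Summit.PneNP.PneNP.Theorems.PstarChordBridgeTools (xpdeg)
open Summit.PneNP.PneNP.Theorems.PstarChordBridgeFundamental (xpdeg_insert)
open Summit.PneNP.PneNP.Theorems.PstarNorUnitAssembly (xpdeg_empty)
open Summit.PneNP.PneNP.Theorems.PstarGSystemFold (fold gval_fold_iff_of_solves)
open Summit.PneNP.PneNP.Theorems.PstarGSystemFreeVar (elimG card_elimG_lt)
open Summit.PneNP.PneNP.Theorems.PstarGapTwoTerminal (Inv inv_fold inv_elim mem_monomials)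
open Summit.PneNP.PneNP.Theorems.PstarChordReadsMirror (gval_pair)
open Summit.PneNP.PneNP.Theorems.PstarChordReadPairCore (PairCore)

namespace Summit.PneNP.PneNP.Theorems.PstarTwoCoreNormal

variable {n m : ℕ}

/-! ## Descendants of a constraint under folding -/
section Descends

variable (I : LocalMap 4 n m) (y : Fin m → Bool)

/-- `d` DESCENDS from the G-constraint `w` by folding the outputs `F`: monomial set `w.2.1 ∪ F`; a variable lies in the linear part of `d` iff
(it lies in `w.1`) agrees with (its XOR slot-degree in `F` is even); and on assignments satisfying every output of `F`, `d` holds iff `w` holds. -/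
def Descends (w : Finset (Fin n) × Finset (Fin m) × Bool) (F : Finset (Fin m)) (d : Finset (Fin n) × Finset (Fin m) × Bool) : Prop :=
  d.2.1 = w.2.1 ∪ F ∧ (∀ v, v ∈ d.1 ↔ (v ∈ w.1 ↔ Even (xpdeg I F v))) ∧
    ∀ z : Fin n → Bool, (∀ f ∈ F, I.eval z f = y f) → (gval I d.1 d.2.1 z = d.2.2 ↔ gval I w.1 w.2.1 z = w.2.2)

/-- A constraint descends from itself (nothing folded). -/
theorem descends_empty (w : Finset (Fin n) × Finset (Fin m) × Bool) : Descends I y w ∅ w := by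
  refine ⟨(union_empty _).symm, fun v => ?_, fun z _ => Iff.rfl⟩
  rw [xpdeg_empty I v]
  simp

variable {I y}

/-- Propositional bookkeeping of the fold step: symmetric difference versus parity flip. -/
theorem symmDiff_iff_helper (A E X : Prop) : ((A ↔ E) ∧ ¬ X ∨ X ∧ ¬ (A ↔ E)) ↔ (A ↔ (E ↔ ¬ X)) := by
  tauto

/-- **Fold step.**  Folding a further output `f ∉ F` (not a monomial of `w`) through an XOR slot present in the linear part of `d`. -/
theorem descends_fold (hI : I.IsPure xorAndPred) {w d : Finset (Fin n) × Finset (Fin m) × Bool} {F : Finset (Fin m)}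
    (h : Descends I y w F d) {f : Fin m} (hfF : f ∉ F) (hfw : f ∉ w.2.1) {t : Fin n} (ht : t ∈ d.1) :
    Descends I y w (insert f F) (fold I y f t d) := by
  classical
  have hfd : f ∉ d.2.1 := by rw [h.1, mem_union, not_or]; exact ⟨hfw, hfF⟩
  have hfold : fold I y f t d = (d.1 ∆ {I.vars f 0, I.vars f 1}, insert f d.2.1, xor d.2.2 (y f)) := by
    unfold PstarGSystemFold.fold; rw [if_pos ht]
  have h01 : I.vars f 0 ≠ I.vars f 1 := fun e => absurd (hI.2 f e) (by decide)
  refine ⟨?_, fun v => ?_, fun z hz => ?_⟩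
  · rw [hfold, h.1]; dsimp only; rw [union_insert]
  · rw [hfold]; dsimp only
    have hpar : Even (xpdeg I (insert f F) v) ↔ (Even (xpdeg I F v) ↔ ¬ (v = I.vars f 0 ∨ v = I.vars f 1)) := by
      rw [xpdeg_insert I hfF]
      by_cases h0 : I.vars f 0 = v
      · have h1 : I.vars f 1 ≠ v := fun e => h01 (h0.trans e.symm)
        rw [if_pos h0, if_neg h1, add_zero, Nat.even_add_one]
        have : v = I.vars f 0 ∨ v = I.vars f 1 := Or.inl h0.symm
        tauto
      · by_cases h1 : I.vars f 1 = v
        · rw [if_neg h0, if_pos h1, add_zero, Nat.even_add_one]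
          have : v = I.vars f 0 ∨ v = I.vars f 1 := Or.inr h1.symm
          tauto
        · rw [if_neg h0, if_neg h1, add_zero, add_zero]
          have : ¬ (v = I.vars f 0 ∨ v = I.vars f 1) := fun h' => h'.elim (fun e => h0 e.symm) (fun e => h1 e.symm)
          tauto
    rw [mem_symmDiff, h.2.1 v, hpar, mem_insert, mem_singleton]
    exact symmDiff_iff_helper _ _ _
  · rw [gval_fold_iff_of_solves I hI y t d hfd (hz f (mem_insert_self f F))]
    exact h.2.2 z fun g hg => hz g (mem_insert_of_mem hg)

/-- A fold through a slot NOT in the linear part leaves the constraint unchanged. -/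
theorem fold_of_not_mem {d : Finset (Fin n) × Finset (Fin m) × Bool} {f : Fin m} {t : Fin n} (ht : t ∉ d.1) : fold I y f t d = d := by
  unfold PstarGSystemFold.fold; rw [if_neg ht]

/-- The monomial set of a descendant. -/
theorem Descends.monomials {w d : Finset (Fin n) × Finset (Fin m) × Bool} {F : Finset (Fin m)} (h : Descends I y w F d) :
    d.2.1 = w.2.1 ∪ F := h.1

/-- Linear variables of a descendant lie in `w.1` or are XOR-slot variables of outputs of `F`. -/
theorem Descends.mem_lin {w d : Finset (Fin n) × Finset (Fin m) × Bool} {F : Finset (Fin m)} (h : Descends I y w F d) {v : Fin n}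
    (hv : v ∈ d.1) : v ∈ w.1 ∨ ∃ f ∈ F, ∃ s : Fin 4, s.val < 2 ∧ I.vars f s = v := by
  classical
  by_cases hvw : v ∈ w.1
  · exact Or.inl hvw
  · right
    have hodd : ¬ Even (xpdeg I F v) := fun he => hvw (((h.2.1 v).1 hv).2 he)
    have hpos : 0 < xpdeg I F v := by
      rcases Nat.eq_zero_or_pos (xpdeg I F v) with h0 | h0
      · exact absurd (h0 ▸ Even.zero) hodd
      · exact h0
    unfold xpdeg PstarXorElimination.pdeg at hpos
    rcases Nat.add_pos_iff_pos_or_pos.1 hpos with hp | hp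
    · obtain ⟨f, hf⟩ := card_pos.1 hp
      rw [mem_filter] at hf
      exact ⟨f, hf.1, 0, by decide, hf.2⟩
    · obtain ⟨f, hf⟩ := card_pos.1 hp
      rw [mem_filter] at hf
      exact ⟨f, hf.1, 1, by decide, hf.2⟩

end Descends

/-! ## Two-constraint systems as `Inv` states -/
section Pair

variable {I : LocalMap 4 n m} {y : Fin m → Bool}

/-- Quantifying over the two-element system. -/
theorem forall_mem_pair {P : Finset (Fin n) × Finset (Fin m) × Bool → Prop} {d₁ d₂ : Finset (Fin n) × Finset (Fin m) × Bool} :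
    (∀ w ∈ ({d₁, d₂} : Finset (Finset (Fin n) × Finset (Fin m) × Bool)), P w) ↔ P d₁ ∧ P d₂ := by
  simp only [mem_insert, mem_singleton, forall_eq_or_imp, forall_eq]

/-- The image of the two-element system under a map. -/
theorem image_pair_constraints (φ : Finset (Fin n) × Finset (Fin m) × Bool → Finset (Fin n) × Finset (Fin m) × Bool)
    (d₁ d₂ : Finset (Fin n) × Finset (Fin m) × Bool) :
    ({d₁, d₂} : Finset (Finset (Fin n) × Finset (Fin m) × Bool)).image φ = {φ d₁, φ d₂} := by
  classical
  rw [image_insert, image_singleton]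

end Pair

/-! ## States with at most one constraint are contradictory -/
section One

variable {I : LocalMap 4 n m} {r : ℕ} {y : Fin m → Bool}

/-- Monomial sets of an `Inv` state are disjoint from the core. -/
theorem disjoint_of_inv {J : Finset (Fin m)} {h : ℕ} {K₀ : Finset (Fin m)} {𝒲 : Finset (Finset (Fin n) × Finset (Fin m) × Bool)}
    (hinv : Inv I y J h K₀ 𝒲) {w : Finset (Fin n) × Finset (Fin m) × Bool} (hw : w ∈ 𝒲) : Disjoint K₀ w.2.1 :=
  disjoint_left.2 fun _ hj hj' => (mem_sdiff.1 (hinv.mono w hw hj')).2 hj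

/-- **A normalisation state with at most one constraint is contradictory** (expanding pure typed instance with simple overlaps, `#K₀ ≤ r`,
`J ≠ ∅`): with no constraint the core alone would be infeasible; with one constraint `w`, either `w` takes both values and `gSat` solves
`K₀ ∧ w`, or `w` is constant, hence has no variables and no monomials, and then (T3)/(M0)/coverage clash. -/
theorem false_of_inv_card_le_one (hI : I.IsPure xorAndPred) (hT : Typed I) (hS : SimpleOverlap I) (hB : BoundaryExpanding r I)
    {J : Finset (Fin m)} {h : ℕ} {K₀ : Finset (Fin m)} {𝒲 : Finset (Finset (Fin n) × Finset (Fin m) × Bool)} (hinv : Inv I y J h K₀ 𝒲)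
    (h1 : 𝒲.card ≤ 1) (hK₀r : K₀.card ≤ r) (hJ : J.Nonempty) : False := by
  classical
  rcases 𝒲.eq_empty_or_nonempty with h𝒲 | hne
  · subst h𝒲
    obtain ⟨z, hz⟩ := feasible_of_boundaryExpanding I hI hB y K₀ hK₀r
    exact hinv.unsat ⟨z, hz, fun w hw => absurd hw (notMem_empty w)⟩
  · obtain ⟨w, hw𝒲⟩ := card_eq_one.1 (le_antisymm h1 (card_pos.2 hne))
    subst hw𝒲
    have hw : w ∈ ({w} : Finset _) := mem_singleton_self w
    by_cases hnc : ∃ z z' : Fin n → Bool, gval I w.1 w.2.1 z ≠ gval I w.1 w.2.1 z'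
    · obtain ⟨z, hz, hzw⟩ := gSat n m r I hI hT hB hS y K₀ w.2.1 w.1 w.2.2 hK₀r (disjoint_of_inv hinv hw) hnc
      exact hinv.unsat ⟨z, hz, fun w' hw' => by rw [mem_singleton.1 hw']; exact hzw⟩
    · push Not at hnc
      have hconst : ∀ z, gval I w.1 w.2.1 z = false := fun z => by rw [hnc z (fun _ => false), gval_false]
      obtain ⟨hnd, hdist⟩ := andPairs_simple I hI hS w.2.1
      obtain ⟨-, hG⟩ := eq_empty_of_gval_const I hnd hdist hconst
      obtain ⟨j, hj⟩ := hJ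
      by_cases hjK : j ∈ K₀
      · cases hb : w.2.2
        · obtain ⟨z, hz⟩ := feasible_of_boundaryExpanding I hI hB y K₀ hK₀r
          exact hinv.unsat ⟨z, hz, fun w' hw' => by rw [mem_singleton.1 hw', hconst, hb]⟩
        · obtain ⟨z, -, hzw⟩ := hinv.min0 j hjK
          have := hzw w hw
          rw [hconst, hb] at this
          exact Bool.false_ne_true this
      · obtain ⟨w', hw', hjw'⟩ := mem_monomials I y hinv (mem_sdiff.2 ⟨hj, hjK⟩)
        rw [mem_singleton.1 hw', hG] at hjw'
        exact notMem_empty j hjw'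

end One

/-! ## The normal form of a two-constraint core -/
section Normal

variable {I : LocalMap 4 n m} {r : ℕ} {y : Fin m → Bool} {K : Finset (Fin m)} {w₁ w₂ : Finset (Fin n) × Finset (Fin m) × Bool}

/-- **The iteration** (folds only): from a state `(K₀, F₁, F₂, d₁, d₂)` — `Inv` for the system `{d₁, d₂}`, `K₀ ⊆ K`, fold sets
`Fᵢ ⊆ K ∖ K₀`, `dᵢ` descending from `wᵢ` by `Fᵢ` — folding reaches such a state whose core is XOR-closed. -/
theorem normal_aux (hI : I.IsPure xorAndPred) (hT : Typed I) (hd₁ : Disjoint K w₁.2.1) (hd₂ : Disjoint K w₂.2.1) {J : Finset (Fin m)} :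
    ∀ (N : ℕ) (K₀ F₁ F₂ : Finset (Fin m)) (d₁ d₂ : Finset (Fin n) × Finset (Fin m) × Bool), K₀.card ≤ N →
      Inv I y J 2 K₀ {d₁, d₂} → K₀ ⊆ K → F₁ ⊆ K \ K₀ → F₂ ⊆ K \ K₀ → Descends I y w₁ F₁ d₁ → Descends I y w₂ F₂ d₂ →
      ∃ (K₁ F₁' F₂' : Finset (Fin m)) (d₁' d₂' : Finset (Fin n) × Finset (Fin m) × Bool),
        Inv I y J 2 K₁ {d₁', d₂'} ∧ K₁ ⊆ K₀ ∧ F₁' ⊆ K \ K₁ ∧ F₂' ⊆ K \ K₁ ∧ Descends I y w₁ F₁' d₁' ∧ Descends I y w₂ F₂' d₂' ∧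
        XorClosed I K₁ := by
  classical
  intro N
  induction N with
  | zero =>
    intro K₀ F₁ F₂ d₁ d₂ hN hinv hK₀ hF₁ hF₂ hD₁ hD₂
    have hK : K₀ = ∅ := card_eq_zero.1 (Nat.le_zero.1 hN)
    exact ⟨K₀, F₁, F₂, d₁, d₂, hinv, Subset.rfl, hF₁, hF₂, hD₁, hD₂, fun f hf => by rw [hK] at hf; exact absurd hf (notMem_empty f)⟩
  | succ N ih =>
    intro K₀ F₁ F₂ d₁ d₂ hN hinv hK₀ hF₁ hF₂ hD₁ hD₂
    by_cases hstep : ∃ f ∈ K₀, ∃ s : Fin 4, s.val < 2 ∧ I.vars f s ∈ bdry I K₀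
    · obtain ⟨f, hf, s, hs, hpriv⟩ := hstep
      have hinv' := inv_fold I hI hT y hinv hf hs hpriv
      rw [image_pair_constraints] at hinv'
      have hfK : f ∈ K := hK₀ hf
      have hfF₁ : f ∉ F₁ := fun h' => (mem_sdiff.1 (hF₁ h')).2 hf
      have hfF₂ : f ∉ F₂ := fun h' => (mem_sdiff.1 (hF₂ h')).2 hf
      have hfw₁ : f ∉ w₁.2.1 := fun h' => disjoint_left.1 hd₁ hfK h'
      have hfw₂ : f ∉ w₂.2.1 := fun h' => disjoint_left.1 hd₂ hfK h'
      have hsub : ∀ {F : Finset (Fin m)}, F ⊆ K \ K₀ → F ⊆ K \ K₀.erase f := fun hF g hg =>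
        mem_sdiff.2 ⟨(mem_sdiff.1 (hF hg)).1, fun h' => (mem_sdiff.1 (hF hg)).2 (mem_of_mem_erase h')⟩
      have hsub' : ∀ {F : Finset (Fin m)}, F ⊆ K \ K₀ → insert f F ⊆ K \ K₀.erase f := fun hF g hg => by
        rcases mem_insert.1 hg with rfl | hg
        · exact mem_sdiff.2 ⟨hfK, notMem_erase _ _⟩
        · exact hsub hF hg
      -- the new fold sets
      have hD₁' : ∃ F₁', F₁' ⊆ K \ K₀.erase f ∧ Descends I y w₁ F₁' (fold I y f (I.vars f s) d₁) := by
        by_cases ht : I.vars f s ∈ d₁.1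
        · exact ⟨insert f F₁, hsub' hF₁, descends_fold hI hD₁ hfF₁ hfw₁ ht⟩
        · exact ⟨F₁, hsub hF₁, by rw [fold_of_not_mem ht]; exact hD₁⟩
      have hD₂' : ∃ F₂', F₂' ⊆ K \ K₀.erase f ∧ Descends I y w₂ F₂' (fold I y f (I.vars f s) d₂) := by
        by_cases ht : I.vars f s ∈ d₂.1
        · exact ⟨insert f F₂, hsub' hF₂, descends_fold hI hD₂ hfF₂ hfw₂ ht⟩
        · exact ⟨F₂, hsub hF₂, by rw [fold_of_not_mem ht]; exact hD₂⟩
      obtain ⟨F₁', hF₁', hD₁'⟩ := hD₁'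
      obtain ⟨F₂', hF₂', hD₂'⟩ := hD₂'
      have hcard : (K₀.erase f).card ≤ N := by
        have := card_erase_lt_of_mem hf; omega
      obtain ⟨K₁, F₁'', F₂'', d₁', d₂', hinv₁, hK₁, hF₁'', hF₂'', hD₁'', hD₂'', hX⟩ :=
        ih _ _ _ _ _ hcard hinv' ((erase_subset f K₀).trans hK₀) hF₁' hF₂' hD₁' hD₂'
      exact ⟨K₁, F₁'', F₂'', d₁', d₂', hinv₁, hK₁.trans (erase_subset f K₀), hF₁'', hF₂'', hD₁'', hD₂'', hX⟩
    · push Not at hstep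
      exact ⟨K₀, F₁, F₂, d₁, d₂, hinv, Subset.rfl, hF₁, hF₂, hD₁, hD₂, fun f hf s hs => hstep f hf s hs⟩

/-- **Coverage**: in an `Inv` state for `{d₁, d₂}` with descendants, every output of `K ∖ K₀` was folded into `d₁` or `d₂`. -/
theorem sdiff_subset_of_inv {J K₀ F₁ F₂ : Finset (Fin m)} {d₁ d₂ : Finset (Fin n) × Finset (Fin m) × Bool}
    (hinv : Inv I y J 2 K₀ {d₁, d₂}) (hKJ : K ⊆ J) (hD₁ : Descends I y w₁ F₁ d₁) (hD₂ : Descends I y w₂ F₂ d₂)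
    (hd₁ : Disjoint K w₁.2.1) (hd₂ : Disjoint K w₂.2.1) : K \ K₀ ⊆ F₁ ∪ F₂ := by
  intro g hg
  obtain ⟨hgK, hgK₀⟩ := mem_sdiff.1 hg
  obtain ⟨w, hw, hgw⟩ := mem_monomials I y hinv (mem_sdiff.2 ⟨hKJ hgK, hgK₀⟩)
  rcases mem_insert.1 hw with rfl | hw
  · rw [hD₁.1, mem_union] at hgw
    rcases hgw with h' | h'
    · exact absurd h' (disjoint_left.1 hd₁ hgK)
    · exact mem_union_left _ h'
  · rw [mem_singleton] at hw; subst hw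
    rw [hD₂.1, mem_union] at hgw
    rcases hgw with h' | h'
    · exact absurd h' (disjoint_left.1 hd₂ hgK)
    · exact mem_union_right _ h'

/-- **THE NORMAL FORM OF A TWO-CONSTRAINT CORE, WITH PROVENANCE.**  Pure typed `(r,3/2)`-expanding instance with simple overlaps; `K ≠ ∅`,
`#K < r`; two G-constraints `w₁, w₂` with monomial outputs off `K` and `#(K ∪ G₁ ∪ G₂) ≤ r`; (T3) `K ∧ w₁ ∧ w₂` unsolvable; (M0) solvable after
deleting any output of `K`; (M′) every monomial `g` of `w₁, w₂` has a solution of `K` violating exactly the constraints containing `g`.  THEN there are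
an XOR-closed `K₀ ⊆ K`, fold sets `F₁, F₂ ⊆ K ∖ K₀` covering `K ∖ K₀`, and DISTINCT descendants `d₁` of `w₁` (by `F₁`) and `d₂` of `w₂` (by `F₂`)
with (T2′) every linear variable read by `K₀` or an AND slot of a monomial of `d₁, d₂`, (T3), (M0) and (M′) for `(K₀, d₁, d₂)`; in particular
`Terminal I r y K₀ d₁ d₂` if `K₀ ≠ ∅`, and `d₁ ∧ d₂` is unsatisfiable over ALL assignments if `K₀ = ∅`. -/
theorem twoCore_normalForm (hI : I.IsPure xorAndPred) (hT : Typed I) (hS : SimpleOverlap I) (hB : BoundaryExpanding r I)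
    (hKne : K.Nonempty) (hKr : K.card < r) (hd₁ : Disjoint K w₁.2.1) (hd₂ : Disjoint K w₂.2.1) (hr : (K ∪ w₁.2.1 ∪ w₂.2.1).card ≤ r)
    (hT3 : ¬ ∃ z : Fin n → Bool, (∀ j ∈ K, I.eval z j = y j) ∧ gval I w₁.1 w₁.2.1 z = w₁.2.2 ∧ gval I w₂.1 w₂.2.1 z = w₂.2.2)
    (hM0 : ∀ f ∈ K, ∃ z : Fin n → Bool, (∀ j ∈ K.erase f, I.eval z j = y j) ∧ gval I w₁.1 w₁.2.1 z = w₁.2.2 ∧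
      gval I w₂.1 w₂.2.1 z = w₂.2.2)
    (hflip : ∀ g ∈ w₁.2.1 ∪ w₂.2.1, ∃ z : Fin n → Bool, (∀ j ∈ K, I.eval z j = y j) ∧
      (gval I w₁.1 w₁.2.1 z = w₁.2.2 ↔ g ∉ w₁.2.1) ∧ (gval I w₂.1 w₂.2.1 z = w₂.2.2 ↔ g ∉ w₂.2.1)) :
    ∃ (K₀ F₁ F₂ : Finset (Fin m)) (d₁ d₂ : Finset (Fin n) × Finset (Fin m) × Bool),
      K₀ ⊆ K ∧ F₁ ⊆ K \ K₀ ∧ F₂ ⊆ K \ K₀ ∧ K \ K₀ ⊆ F₁ ∪ F₂ ∧ d₁ ≠ d₂ ∧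
      Descends I y w₁ F₁ d₁ ∧ Descends I y w₂ F₂ d₂ ∧ XorClosed I K₀ ∧
      (∀ v ∈ d₁.1 ∪ d₂.1, (∃ f ∈ K₀, v ∈ varSet I f) ∨ ∃ g ∈ d₁.2.1 ∪ d₂.2.1, I.vars g 2 = v ∨ I.vars g 3 = v) ∧
      (¬ ∃ z : Fin n → Bool, (∀ j ∈ K₀, I.eval z j = y j) ∧ gval I d₁.1 d₁.2.1 z = d₁.2.2 ∧ gval I d₂.1 d₂.2.1 z = d₂.2.2) ∧
      (∀ f ∈ K₀, ∃ z : Fin n → Bool, (∀ j ∈ K₀.erase f, I.eval z j = y j) ∧ gval I d₁.1 d₁.2.1 z = d₁.2.2 ∧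
        gval I d₂.1 d₂.2.1 z = d₂.2.2) ∧
      (∀ g ∈ (K \ K₀) ∪ (w₁.2.1 ∪ w₂.2.1), ∃ z : Fin n → Bool, (∀ j ∈ K₀, I.eval z j = y j) ∧
        (gval I d₁.1 d₁.2.1 z = d₁.2.2 ↔ g ∉ d₁.2.1) ∧ (gval I d₂.1 d₂.2.1 z = d₂.2.2 ↔ g ∉ d₂.2.1)) ∧
      (K₀.Nonempty → Terminal I r y K₀ d₁ d₂) ∧
      (K₀ = ∅ → ∀ z : Fin n → Bool, ¬ (gval I d₁.1 d₁.2.1 z = d₁.2.2 ∧ gval I d₂.1 d₂.2.1 z = d₂.2.2)) := by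
  classical
  set J : Finset (Fin m) := K ∪ w₁.2.1 ∪ w₂.2.1 with hJ
  have hKJ : K ⊆ J := fun j hj => mem_union_left _ (mem_union_left _ hj)
  have hJne : J.Nonempty := hKne.mono hKJ
  -- the initial state
  have hinv₀ : Inv I y J 2 K {w₁, w₂} := by
    refine ⟨hKJ, card_insert_le _ _, fun w hw => ?_, ?_, fun f hf => ?_, fun g hg => ?_⟩
    · rcases mem_insert.1 hw with rfl | hw'
      · exact fun g hg => mem_sdiff.2 ⟨mem_union_left _ (mem_union_right _ hg), fun hgK => disjoint_left.1 hd₁ hgK hg⟩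
      · rw [mem_singleton] at hw'; subst hw'
        exact fun g hg => mem_sdiff.2 ⟨mem_union_right _ hg, fun hgK => disjoint_left.1 hd₂ hgK hg⟩
    · rintro ⟨z, hz, hzw⟩
      exact hT3 ⟨z, hz, (forall_mem_pair.1 hzw).1, (forall_mem_pair.1 hzw).2⟩
    · obtain ⟨z, hz, hz₁, hz₂⟩ := hM0 f hf
      exact ⟨z, hz, forall_mem_pair.2 ⟨hz₁, hz₂⟩⟩
    · have hg' : g ∈ w₁.2.1 ∪ w₂.2.1 := by
        obtain ⟨hgJ, hgK⟩ := mem_sdiff.1 hg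
        rcases mem_union.1 hgJ with h' | h'
        · rcases mem_union.1 h' with h'' | h''
          · exact absurd h'' hgK
          · exact mem_union_left _ h''
        · exact mem_union_right _ h'
      obtain ⟨z, hz, hz₁, hz₂⟩ := hflip g hg'
      exact ⟨z, hz, forall_mem_pair.2 ⟨hz₁, hz₂⟩⟩
  -- iterate
  obtain ⟨K₀, F₁, F₂, d₁, d₂, hinv, hK₀, hF₁, hF₂, hD₁, hD₂, hX⟩ :=
    normal_aux hI hT hd₁ hd₂ _ K ∅ ∅ w₁ w₂ le_rfl hinv₀ Subset.rfl (empty_subset _) (empty_subset _) (descends_empty I y w₁)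
      (descends_empty I y w₂)
  have hK₀r : K₀.card ≤ r := ((card_le_card hK₀).trans hKr.le)
  -- two distinct constraints survive
  have hne : d₁ ≠ d₂ := by
    intro heq
    refine false_of_inv_card_le_one hI hT hS hB hinv ?_ hK₀r hJne
    rw [heq, pair_eq_singleton, card_singleton]
  have hd₁𝒲 : d₁ ∈ ({d₁, d₂} : Finset (Finset (Fin n) × Finset (Fin m) × Bool)) := mem_insert_self _ _
  have hd₂𝒲 : d₂ ∈ ({d₁, d₂} : Finset (Finset (Fin n) × Finset (Fin m) × Bool)) := mem_insert_of_mem (mem_singleton_self _)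
  have hcard𝒲 : ({d₁, d₂} : Finset (Finset (Fin n) × Finset (Fin m) × Bool)).card = 2 := card_pair hne
  -- (T2′): no free linear variable, else a row reduction would leave one constraint
  have hT2 : ∀ v ∈ d₁.1 ∪ d₂.1, (∃ f ∈ K₀, v ∈ varSet I f) ∨ ∃ g ∈ d₁.2.1 ∪ d₂.2.1, I.vars g 2 = v ∨ I.vars g 3 = v := by
    intro v hv
    by_contra hno
    push Not at hno
    obtain ⟨hnoJ, hnoG⟩ := hno
    have hvG : ∀ w ∈ ({d₁, d₂} : Finset (Finset (Fin n) × Finset (Fin m) × Bool)), ∀ g ∈ w.2.1, I.vars g 2 ≠ v ∧ I.vars g 3 ≠ v :=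
      forall_mem_pair.2 ⟨fun g hg => hnoG g (mem_union_left _ hg), fun g hg => hnoG g (mem_union_right _ hg)⟩
    rcases mem_union.1 hv with hv | hv
    · have hinv' := inv_elim I y hinv hd₁𝒲 hv hnoJ hvG
      have hlt := card_elimG_lt hd₁𝒲 v
      exact false_of_inv_card_le_one hI hT hS hB hinv' (by rw [hcard𝒲] at hlt; omega) hK₀r hJne
    · have hinv' := inv_elim I y hinv hd₂𝒲 hv hnoJ hvG
      have hlt := card_elimG_lt hd₂𝒲 v
      exact false_of_inv_card_le_one hI hT hS hB hinv' (by rw [hcard𝒲] at hlt; omega) hK₀r hJne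
  -- (T3), (M0), (M′) for the pair
  have hT3' : ¬ ∃ z : Fin n → Bool, (∀ j ∈ K₀, I.eval z j = y j) ∧ gval I d₁.1 d₁.2.1 z = d₁.2.2 ∧ gval I d₂.1 d₂.2.1 z = d₂.2.2 := by
    rintro ⟨z, hz, hz₁, hz₂⟩
    exact hinv.unsat ⟨z, hz, forall_mem_pair.2 ⟨hz₁, hz₂⟩⟩
  have hM0' : ∀ f ∈ K₀, ∃ z : Fin n → Bool, (∀ j ∈ K₀.erase f, I.eval z j = y j) ∧ gval I d₁.1 d₁.2.1 z = d₁.2.2 ∧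
      gval I d₂.1 d₂.2.1 z = d₂.2.2 := fun f hf => by
    obtain ⟨z, hz, hzw⟩ := hinv.min0 f hf
    exact ⟨z, hz, (forall_mem_pair.1 hzw).1, (forall_mem_pair.1 hzw).2⟩
  have hflip' : ∀ g ∈ (K \ K₀) ∪ (w₁.2.1 ∪ w₂.2.1), ∃ z : Fin n → Bool, (∀ j ∈ K₀, I.eval z j = y j) ∧
      (gval I d₁.1 d₁.2.1 z = d₁.2.2 ↔ g ∉ d₁.2.1) ∧ (gval I d₂.1 d₂.2.1 z = d₂.2.2 ↔ g ∉ d₂.2.1) := fun g hg => by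
    have hgJ : g ∈ J \ K₀ := by
      rcases mem_union.1 hg with hg | hg
      · exact mem_sdiff.2 ⟨hKJ (mem_sdiff.1 hg).1, (mem_sdiff.1 hg).2⟩
      · refine mem_sdiff.2 ⟨?_, fun hgK₀ => ?_⟩
        · rcases mem_union.1 hg with h' | h'
          · exact mem_union_left _ (mem_union_right _ h')
          · exact mem_union_right _ h'
        · rcases mem_union.1 hg with h' | h'
          · exact disjoint_left.1 hd₁ (hK₀ hgK₀) h'
          · exact disjoint_left.1 hd₂ (hK₀ hgK₀) h'
    obtain ⟨z, hz, hzw⟩ := hinv.flip g hgJ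
    exact ⟨z, hz, (forall_mem_pair.1 hzw).1, (forall_mem_pair.1 hzw).2⟩
  -- radius bookkeeping
  have hmono₁ : d₁.2.1 ⊆ J := fun g hg => (mem_sdiff.1 (hinv.mono d₁ hd₁𝒲 hg)).1
  have hmono₂ : d₂.2.1 ⊆ J := fun g hg => (mem_sdiff.1 (hinv.mono d₂ hd₂𝒲 hg)).1
  have hrad : (K₀ ∪ d₁.2.1 ∪ d₂.2.1).card ≤ r :=
    (card_le_card (union_subset (union_subset (hK₀.trans hKJ) hmono₁) hmono₂)).trans hr
  refine ⟨K₀, F₁, F₂, d₁, d₂, hK₀, hF₁, hF₂, sdiff_subset_of_inv hinv hKJ hD₁ hD₂ hd₁ hd₂, hne, hD₁, hD₂, hX, hT2, hT3', hM0', hflip',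
    fun hK₀ne => ⟨hK₀ne, hX, lt_of_le_of_lt (card_le_card hK₀) hKr, disjoint_of_inv hinv hd₁𝒲, disjoint_of_inv hinv hd₂𝒲, hrad, hT3',
      hM0'⟩, fun hK₀e z hz => hT3' ⟨z, fun j hj => ?_, hz⟩⟩
  rw [hK₀e] at hj
  exact absurd hj (notMem_empty j)

end Normal

end Summit.PneNP.PneNP.Theorems.PstarTwoCoreNormal
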